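import Literature.NumberTheory.NumberFields.AbsoluteGaloisGroupNotSolvable
import Literature.NumberTheory.GaloisRepresentations.AbsGaloisGroupCompact
import HarnessLib

/-!
# The prosolvable radical of the absolute Galois group of a number field is non-trivial

Topic `Literature/NumberTheory/NumberFields`.  Theorem-only file (no definition, no named fact),
classical; Mathlib vocabulary (`Field.absoluteGaloisGroup`, `Subgroup`, `IsSolvable`, quotient
groups, Krull topology) plus the tree's `absoluteGaloisGroup_compactSpace`.

For a profinite (here: compact topological) group `Γ` write `Γ^{[sol]} := ⋂ {N ⊴ Γ open :
Γ ⧸ N solvable}` = `Ker(Γ ↠ Γ^{sol})`, the kernel of the maximal prosolvable quotient.  We do not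
introduce this as a definition; the two theorems below quantify over the open normal co-solvable
subgroups directly.

* `exists_ne_one_forall_mem_of_not_isSolvable_quotient` (general compact groups; Ribes–Zalesskii,
  *Profinite Groups*, Thm 2.1.3 — the co-`𝒞` open normal subgroups of a pro-`𝒞` group form a
  neighbourhood basis of `1`): if SOME open normal subgroup `U` has a non-solvable quotient, then
  the co-solvable open normal subgroups have a common element `σ ≠ 1` — i.e. `Γ^{[sol]} ≠ 1`.
  (Compactness: otherwise finitely many co-solvable `Nᵢ` already satisfy `⋂ Nᵢ ≤ U`, and
  `Γ ⧸ ⋂ Nᵢ ↪ ∏ Γ ⧸ Nᵢ` is solvable, so its quotient `Γ ⧸ U` would be solvable.)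
* `exists_ne_one_forall_mem_absoluteGaloisGroup`: for a number field `F`,
  `Gal(F̄/F)^{[sol]} ≠ 1` — there is `σ ∈ Gal(F̄/F)`, `σ ≠ 1`, lying in EVERY open normal subgroup
  with solvable quotient (from `exists_isOpen_normal_quotient_not_isSolvable` of
  `AbsoluteGaloisGroupNotSolvable.lean`).  This is the form "`Ker(G_{F} ↠ G_{F}^{sol}) ≠ 1`" in
  which the fact enters, e.g., [IUTchI] Ex 5.1 (i)/(v) and Rmk 5.1.5 (the subgroup `solKer`);
  nothing of that corpus is used or asserted here.

## References

* L. Ribes, P. Zalesskii, *Profinite Groups*, 2nd ed. (2010), §2.1, Thm 2.1.3.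
* J. Neukirch, A. Schmidt, K. Wingberg, *Cohomology of Number Fields*, 2nd ed. (2008), Ch. IX §5.
-/

namespace Literature.NumberTheory.NumberFields

open Literature.NumberTheory.GaloisRepresentations

/-! ### §1. Compact groups: a non-solvable open quotient forces a non-trivial prosolvable kernel -/

/-- **Non-trivial prosolvable kernel** (compactness argument behind Ribes–Zalesskii Thm 2.1.3).
Let `Γ` be a compact topological group with an open normal subgroup `U` such that `Γ ⧸ U` is not
solvable.  Then there is `σ ≠ 1` in `Γ` contained in every open normal subgroup `N` with `Γ ⧸ N`
solvable (i.e. the intersection `Γ^{[sol]}` of the co-solvable open normal subgroups is not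
trivial).  Proof: if not, the complements of the co-solvable `N` cover the compact set `Γ ∖ U`;
a finite subcover gives `N₁ ∩ ⋯ ∩ Nᵣ ≤ U` with `Γ ⧸ ⋂ Nᵢ ↪ ∏ Γ ⧸ Nᵢ` solvable, whence `Γ ⧸ U`
solvable. [cite: RibesZalesskii2010, Thm 2.1.3] -/
theorem exists_ne_one_forall_mem_of_not_isSolvable_quotient {Γ : Type*} [Group Γ]
    [TopologicalSpace Γ] [IsTopologicalGroup Γ] [CompactSpace Γ]
    (U : Subgroup Γ) [U.Normal] (hUo : IsOpen (U : Set Γ)) (hU : ¬ IsSolvable (Γ ⧸ U)) :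
    ∃ σ : Γ, σ ≠ 1 ∧ ∀ (N : Subgroup Γ) (_ : N.Normal), IsOpen (N : Set Γ) →
      IsSolvable (Γ ⧸ N) → σ ∈ N := by
  classical
  by_contra hcon
  -- every `σ ≠ 1` is avoided by some co-solvable open normal subgroup
  have hcov : ∀ σ : Γ, σ ≠ 1 → ∃ (N : Subgroup Γ) (_ : N.Normal), IsOpen (N : Set Γ) ∧
      IsSolvable (Γ ⧸ N) ∧ σ ∉ N := by
    intro σ hσ
    by_contra h'
    apply hcon
    refine ⟨σ, hσ, fun N hN hNo hNs => ?_⟩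
    by_contra hmem
    exact h' ⟨N, hN, hNo, hNs, hmem⟩
  -- index the cover by the points outside `U`
  have hι : ∀ i : {σ : Γ // σ ∉ U}, (i : Γ) ≠ 1 := fun i h => i.2 (h ▸ U.one_mem)
  choose N hNn hNo hNs hNmem using fun i : {σ : Γ // σ ∉ U} => hcov i (hι i)
  have hcompact : IsCompact ((U : Set Γ)ᶜ) := hUo.isClosed_compl.isCompact
  obtain ⟨t, ht⟩ := hcompact.elim_finite_subcover (fun i => ((N i : Set Γ))ᶜ)
    (fun i => (Subgroup.isClosed_of_isOpen _ (hNo i)).isOpen_compl)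
    (fun x hx => Set.mem_iUnion.mpr ⟨⟨x, hx⟩, hNmem ⟨x, hx⟩⟩)
  -- a finite intersection of co-solvable normal subgroups is co-solvable
  have key : ∀ s : Finset {σ : Γ // σ ∉ U}, ∃ (M : Subgroup Γ) (_ : M.Normal),
      IsSolvable (Γ ⧸ M) ∧ ∀ i ∈ s, M ≤ N i := by
    intro s
    induction s using Finset.induction_on with
    | empty =>
      refine ⟨⊤, inferInstance, ?_, by simp⟩
      haveI := QuotientGroup.subsingleton_quotient_top (G := Γ)
      exact isSolvable_of_comm fun a b => Subsingleton.elim _ _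
    | insert i s _ ih =>
      obtain ⟨M, hM, hMs, hle⟩ := ih
      haveI := hNn i
      haveI := hNs i
      let f : Γ →* (Γ ⧸ M) × (Γ ⧸ N i) := (QuotientGroup.mk' M).prod (QuotientGroup.mk' (N i))
      have hker : f.ker = M ⊓ N i := by
        rw [MonoidHom.ker_prod, QuotientGroup.ker_mk', QuotientGroup.ker_mk']
      refine ⟨f.ker, inferInstance, ?_, ?_⟩
      · exact solvable_of_solvable_injective (QuotientGroup.kerLift_injective f)
      · intro j hj
        rw [Finset.mem_insert] at hj
        rcases hj with rfl | hj
        · rw [hker]; exact inf_le_right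
        · rw [hker]; exact inf_le_left.trans (hle j hj)
  obtain ⟨M, hM, hMs, hle⟩ := key t
  -- the finite intersection lies in `U`
  have hMU : M ≤ U := by
    intro x hx
    by_contra hxU
    obtain ⟨i, hi, hx'⟩ := Set.mem_iUnion₂.mp (ht hxU)
    exact hx' (hle i hi hx)
  -- so `Γ ⧸ U`, a quotient of `Γ ⧸ M`, is solvable
  apply hU
  refine solvable_of_surjective
    (f := QuotientGroup.map M U (MonoidHom.id Γ) (by rwa [Subgroup.comap_id])) ?_
  intro y
  obtain ⟨x, rfl⟩ := QuotientGroup.mk_surjective y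
  exact ⟨QuotientGroup.mk x, rfl⟩

/-! ### §2. Number fields -/

variable (F : Type*) [Field F] [NumberField F]

/-- **`Ker(Gal(F̄/F) ↠ Gal(F̄/F)^{sol}) ≠ 1` for a number field `F`.**  There is an element
`σ ≠ 1` of the absolute Galois group `Γ_F = Gal(F̄/F)` lying in EVERY open normal subgroup `N`
with `Γ_F ⧸ N` solvable — i.e. the kernel of the maximal prosolvable quotient of `Γ_F` (the
closed normal subgroup `Gal(F̄/F^{sol})`) is non-trivial; equivalently `F^{sol} ≠ F̄`.
From `exists_isOpen_normal_quotient_not_isSolvable` (an `S_p`-extension of `F`) and the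
compactness lemma `exists_ne_one_forall_mem_of_not_isSolvable_quotient`.
[cite: NeukirchSchmidtWingberg2008, Ch. IX §5; RibesZalesskii2010, Thm 2.1.3] -/
theorem exists_ne_one_forall_mem_absoluteGaloisGroup :
    ∃ σ : Field.absoluteGaloisGroup F, σ ≠ 1 ∧
      ∀ (N : Subgroup (Field.absoluteGaloisGroup F)) (_ : N.Normal),
        IsOpen (N : Set (Field.absoluteGaloisGroup F)) →
        IsSolvable (Field.absoluteGaloisGroup F ⧸ N) → σ ∈ N := by
  haveI : CompactSpace (Field.absoluteGaloisGroup F) := absoluteGaloisGroup_compactSpace F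
  obtain ⟨U, hU, hUo, hUs⟩ := exists_isOpen_normal_quotient_not_isSolvable F
  exact exists_ne_one_forall_mem_of_not_isSolvable_quotient U hUo hUs

end Literature.NumberTheory.NumberFields
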